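import Literature.MathematicalPhysics.QuantumFieldTheory.Balaban1983to89.B11LeafUnpinnedRecord
import Literature.MathematicalPhysics.QuantumFieldTheory.Balaban1983to89.B9LeafUnpinnedRecord5C
import Literature.MathematicalPhysics.QuantumFieldTheory.Balaban1983to89.Node00.Record8Inhabited

/-!
# `Balaban1983to89.B9LeafRecord8C` — DAG node N06 · [Balaban1985BackgroundPropagators] at NODE 00's record predicates of record `Node00.IsRecordOfRecord₅C`
# and `Node00.IsRecordOfRecord₈C` NOW THAT N01–N04 ARE DISCHARGED THERE: at every record N06 IS ITS OWN LEAF (`Dag.B9_main ↔ b9`); the universal form of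
# N06 over either predicate is REFUTABLE outright (not only «given N03»), its `∃`-dual junk-provable; and the one-line SOCKET a [B9]-pinning stage plugs into

B9 = T. Bałaban, *Propagators for lattice gauge theories in a background field*, Commun. Math. Phys. **99** (1985) 389–434 [Balaban1985BackgroundPropagators].
YM-PLAN Track A, node N06 = `Dag.B9_main ℓ := ℓ.b4 → ℓ.b5 → ℓ.b6 → ℓ.b7 → ℓ.b9`; seat `pub-ymgap-dag-n06-a` (KNIT-BY-NAME, g3).  THEOREMS ONLY (0 `def`, 0 `sorry`).

WHY (successor protocol of `HANDOFF-dag-n06-a.md` §4 (ii); ref-A's N06-FRAME-NOTE, pub-ymgap INBOX l.10185).  Since this seat's ₅∕₅C census (`B9LeafUnpinnedRecord5`,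
`B9LeafUnpinnedRecord5C`: N06 undetermined, the negative side stated «given N03's antecedents»), NODE 00 closed N03 hypothesis-free at the records
(`Node00.N03_at_record₅C`, R443) and landed the Stage-8 record predicate `IsRecordOfRecord₈C` (p414247) with an inhabitation theorem (`Node00.Record8Inhabited.exists_isRecordOfRecord₈C`,
dag-n23-b p416375).  Consequences recorded here, each a few lines over landed theorems:
* §1 AT A RECORD THE NODE IS ITS LEAF: `b9_main_iff_leaf_of_isRecordOfRecord₅C ∕ ₈C` — all four in-edges `b4, b5, b6, b7` are theorems of the record
  (`Node00.b4∕b5∕b7_main_of_isRecordOfRecord₅C`, `Node00.N03_at_record₅C`), so `Dag.B9_main (leavesP w P) ↔ (leavesP w P).b9`; at binding parameters θ the leaf is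
  `B9LeafX (θ.res.Y P)` (`forall_b9_main_iff_pinned₅C ∕ ₈C`) — the SOCKET: a Stage-3′(Y) theorem `∀ P, B9LeafX (Y9OfRecord θ P)` closes N06 at its records by one line
  (`b9_main_of_isRecordOfRecord₅C_of_leaf ∕ ₈C_of_leaf`).
* §2 SAME-DATUM CENSUS over ₈C (n07-a's re-binding device `B11LeafUnpinnedRecord.isRecordOfRecord₈C_updXYZ`, p416215): given ONE ₈C record, every [B9] bundle occurs at an
  ₈C record over the SAME datum (`exists_record₈C_b9_iff`); hence one at which N06 FAILS at every run (`exists_record₈C_not_b9_main`, the refuting bundle of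
  `B9LeafUnpinned.exists_not_b9LeafX`) and one at which it HOLDS at every run (`exists_record₈C_b9_main`, the zero-operator bundle of `B9LeafKnitNonVacuity`).
* §3 ABSOLUTE FORMS: `not_b9_main_over_record₅C` (ref-A's probe `probe_n06_refutable_over_record₅C`, now in the tree), `not_b9_main_over_record₈C`,
  `b9_main_undetermined_over_record₈C` (the §4 template of `B9LeafUnpinnedRecord5C` instantiated at ₈C) — a `stub_N06` typed over ₅C or ₈C would be FALSE; the
  Stage-3′(Y) pin (`HOME/pub-ymgap-dag-n06-a/B9-PIN-DESIGN-g2.md`) is required, exactly as for ₂∕₃∕₅.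
HONEST FRAMING: count-neutral kernel census; N06 NOT discharged; nothing asserted about [B9] at Bałaban's objects (the §2 carriers are DEGENERATE probes); one finite T⁴
programme at fixed ε; nothing continuum ∕ ℝ⁴ ∕ OS ∕ mass-gap ∕ Clay.
-/

noncomputable section

namespace Literature.MathematicalPhysics.QuantumFieldTheory.Balaban1983to89.B9LeafRecord8C

open DagBinding DagDischargedII T4Continuum Node00
open B11LeafUnpinnedRecord (isRecordOfRecord₅C_updXYZ isRecordOfRecord₈C_updXYZ upOfRecord₅C_b8_b9_b11)

variable {F : T4Family} {N : ℕ} [NeZero N] {D : FiniteEpsData F (SU N)} {w : WorldP}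

/-! ## §1 At a record of record, N06 is its own leaf; the socket for a pinning stage -/

/-- **At a ₅C record, N06 ⇔ its [B9] leaf**: the in-edges `b4` (N01), `b5` (N02), `b6` (N03, `Node00.N03_at_record₅C`), `b7` (N04) hold at every run of every ₅C record.
[cite: Balaban1985BackgroundPropagators, Thms 3.1–3.15 pp.397–432 (bookkeeping: the node at a record of record)] -/
theorem b9_main_iff_leaf_of_isRecordOfRecord₅C (h : IsRecordOfRecord₅C F N D w) (P : B12.RunParams) :
    Dag.B9_main (leavesP w P) ↔ (leavesP w P).b9 := by
  have h4 : (leavesP w P).b4 := b4_main_of_isRecordOfRecord₅C h P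
  have h5 : (leavesP w P).b5 := b5_main_of_isRecordOfRecord₅C h P h4
  have h6 : (leavesP w P).b6 := N03_at_record₅C h P h4 h5
  have h7 : (leavesP w P).b7 := b7_main_of_isRecordOfRecord₅C h P h5
  exact ⟨fun hN => B9LeafKnit.b9_of_b9_main hN h4 h5 h6 h7, B9LeafKnit.b9_main_of_b9⟩

/-- **At an ₈C record, N06 ⇔ its [B9] leaf** (refinement ₈C → ₅C). [cite: Balaban1985BackgroundPropagators, Thms 3.1–3.15 pp.397–432 (bookkeeping)] -/
theorem b9_main_iff_leaf_of_isRecordOfRecord₈C (h : IsRecordOfRecord₈C F N D w) (P : B12.RunParams) :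
    Dag.B9_main (leavesP w P) ↔ (leavesP w P).b9 :=
  b9_main_iff_leaf_of_isRecordOfRecord₅C (isRecordOfRecord₅C_of_isRecordOfRecord₈C h) P

/-- **At a world bound by Stage-5 parameters θ, «N06 at every run» ⇔ «the typed [B9] leaf of the RESIDUAL bundle `θ.res.Y P` at every run»** — the precise
sense in which N06 over ₅C reads an un-pinned bundle. [cite: Balaban1985BackgroundPropagators, Thms 3.1–3.15 pp.397–432 (bookkeeping: the leaf at binding parameters)] -/
theorem forall_b9_main_iff_pinned₅C (h : IsRecordOfRecord₅C F N D w) {θ : Stage5Params F N}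
    (hup : ∀ P, w.up P = upOfRecord₅C F N θ P) :
    (∀ P : B12.RunParams, Dag.B9_main (leavesP w P)) ↔ ∀ P : B12.RunParams, B9LeafX (θ.res.Y P) := by
  refine forall_congr' fun P => (b9_main_iff_leaf_of_isRecordOfRecord₅C h P).trans ?_
  show (w.up P).b9 ↔ _
  rw [hup P]
  exact (upOfRecord₅C_b8_b9_b11 θ P).2.1

/-- The ₈C twin: at binding Stage-8 parameters θ, «N06 at every run» ⇔ `∀ P, B9LeafX (θ.res.Y P)`.
[cite: Balaban1985BackgroundPropagators, Thms 3.1–3.15 pp.397–432 (bookkeeping: the leaf at binding parameters)] -/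
theorem forall_b9_main_iff_pinned₈C (h : IsRecordOfRecord₈C F N D w) {θ : Stage8Params F N}
    (hup : ∀ P, w.up P = upOfRecord₅C F N (θ.toStage5 F N) P) :
    (∀ P : B12.RunParams, Dag.B9_main (leavesP w P)) ↔ ∀ P : B12.RunParams, B9LeafX (θ.res.Y P) :=
  forall_b9_main_iff_pinned₅C (isRecordOfRecord₅C_of_isRecordOfRecord₈C h) hup

/-- **THE SOCKET**: at a ₅C record, a proof of the world's [B9] leaf at every run IS a proof of N06 at every run (what a Stage-3′(Y) theorem
`∀ P, B9LeafX (Y9OfRecord θ P)` plugs into, cf. `Node00.N03_at_record₅C`). [cite: Balaban1985BackgroundPropagators, Thms 3.1–3.15 pp.397–432 (bookkeeping)] -/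
theorem b9_main_of_isRecordOfRecord₅C_of_leaf (_h : IsRecordOfRecord₅C F N D w) (hY : ∀ P : B12.RunParams, (leavesP w P).b9)
    (P : B12.RunParams) : Dag.B9_main (leavesP w P) :=
  B9LeafKnit.b9_main_of_b9 (hY P)

/-- The ₈C socket. [cite: Balaban1985BackgroundPropagators, Thms 3.1–3.15 pp.397–432 (bookkeeping)] -/
theorem b9_main_of_isRecordOfRecord₈C_of_leaf (_h : IsRecordOfRecord₈C F N D w) (hY : ∀ P : B12.RunParams, (leavesP w P).b9)
    (P : B12.RunParams) : Dag.B9_main (leavesP w P) :=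
  B9LeafKnit.b9_main_of_b9 (hY P)

/-! ## §2 Same-datum census over ₈C: every bundle occurs; N06 fails at one record and holds at another -/

/-- **Given ONE ₈C record, every [B9] bundle `Y` occurs at an ₈C record over the SAME datum** (swap the residual family `Y ↦ fun _ => Y`; the Stage-8 overwrites and the
datum do not read it — n07-a's `isRecordOfRecord₈C_updXYZ`). [cite: Balaban1985BackgroundPropagators, Thms 3.1–3.15 pp.397–432 (bookkeeping: the [B9] group is residual at Stage 8)] -/
theorem exists_record₈C_b9_iff (h : IsRecordOfRecord₈C F N D w) (Y : PrintedCarriers9X) :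
    ∃ w' : WorldP, IsRecordOfRecord₈C F N D w' ∧ ∀ P : B12.RunParams, ((leavesP w' P).b9 ↔ B9LeafX Y) := by
  obtain ⟨θ, -, -, hrec⟩ := isRecordOfRecord₈C_updXYZ h
  refine ⟨_, hrec θ.res.X (fun _ => Y) θ.res.Z, fun P => ?_⟩
  exact (upOfRecord₅C_b8_b9_b11
    (Stage8Params.toStage5 F N { θ with res := { θ.res with X := θ.res.X, Y := fun _ => Y, Z := θ.res.Z } }) P).2.1

/-- **Given ONE ₈C record, there is an ₈C record over the SAME datum at which N06 FAILS AT EVERY RUN** — outright, not only given N03: the refuting bundle of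
`B9LeafUnpinned.exists_not_b9LeafX` in the `Y` slot, the four in-edges being theorems of the record.
[cite: Balaban1985BackgroundPropagators, Thm 3.1 (3.42) p.397 (bookkeeping: the typed statement over a degenerate bundle at a Stage-8 record)] -/
theorem exists_record₈C_not_b9_main (h : IsRecordOfRecord₈C F N D w) :
    ∃ w' : WorldP, IsRecordOfRecord₈C F N D w' ∧ ∀ P : B12.RunParams, ¬ Dag.B9_main (leavesP w' P) := by
  obtain ⟨Y, -, hY⟩ := B9LeafUnpinned.exists_not_b9LeafX
  obtain ⟨w', hw', hb9⟩ := exists_record₈C_b9_iff h Y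
  exact ⟨w', hw', fun P hN => hY ((hb9 P).1 ((b9_main_iff_leaf_of_isRecordOfRecord₈C hw' P).1 hN))⟩

/-- **Given ONE ₈C record, there is an ₈C record over the SAME datum at which the [B9] leaf — hence N06 — HOLDS at every run** (the zero-operator bundle of
`B9LeafKnitNonVacuity.exists_b9LeafX_of_vanishing_operators`; vacuous content). [cite: Balaban1985BackgroundPropagators, Thms 3.1–3.15 pp.397–432 (bookkeeping: the `∃`-dual at Stage 8 is junk-provable)] -/
theorem exists_record₈C_b9_main (h : IsRecordOfRecord₈C F N D w) :
    ∃ w' : WorldP, IsRecordOfRecord₈C F N D w' ∧ ∀ P : B12.RunParams, (leavesP w' P).b9 ∧ Dag.B9_main (leavesP w' P) := by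
  obtain ⟨Y, -, -, -, hY⟩ := B9LeafKnitNonVacuity.exists_b9LeafX_of_vanishing_operators
  obtain ⟨w', hw', hb9⟩ := exists_record₈C_b9_iff h Y
  exact ⟨w', hw', fun P => ⟨(hb9 P).2 hY, B9LeafKnit.b9_main_of_b9 ((hb9 P).2 hY)⟩⟩

/-- **«N06 at every run of every ₈C record world over the datum» is FALSE** (given one ₈C record). [cite: Balaban1985BackgroundPropagators, Thms 3.1–3.15 pp.397–432 (bookkeeping)] -/
theorem not_forall_record₈C_b9_main (h : IsRecordOfRecord₈C F N D w) :
    ¬ ∀ w' : WorldP, IsRecordOfRecord₈C F N D w' → ∀ P : B12.RunParams, Dag.B9_main (leavesP w' P) := by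
  obtain ⟨w', hw', hno⟩ := exists_record₈C_not_b9_main h
  exact fun hall => hno ⟨0, 0, 0⟩ (hall w' hw' ⟨0, 0, 0⟩)

/-- The same-datum census over ₅C in the outright form (the ₅C module's negative side was stated «given N03»; with `Node00.N03_at_record₅C` it is absolute).
[cite: Balaban1985BackgroundPropagators, Thms 3.1–3.15 pp.397–432 (bookkeeping)] -/
theorem exists_record₅C_not_b9_main (h : IsRecordOfRecord₅C F N D w) :
    ∃ w' : WorldP, IsRecordOfRecord₅C F N D w' ∧ ∀ P : B12.RunParams, ¬ Dag.B9_main (leavesP w' P) := by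
  obtain ⟨Y, -, hY⟩ := B9LeafUnpinned.exists_not_b9LeafX
  obtain ⟨θ, -, -, hrec⟩ := isRecordOfRecord₅C_updXYZ h
  refine ⟨_, hrec θ.res.X (fun _ => Y) θ.res.Z, fun P hN => hY ?_⟩
  have hw' := hrec θ.res.X (fun _ => Y) θ.res.Z
  exact (upOfRecord₅C_b8_b9_b11 ({ θ with res := { θ.res with X := θ.res.X, Y := fun _ => Y, Z := θ.res.Z } } : Stage5Params F N) P).2.1.1
    ((b9_main_iff_leaf_of_isRecordOfRecord₅C hw' P).1 hN)

/-! ## §3 Absolute forms over the two record predicates of record -/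

/-- **N06 AS TYPED IS REFUTABLE OVER `IsRecordOfRecord₅C`** (ref-A's probe `probe_n06_refutable_over_record₅C`, now in the tree): the ₅C module's conditional refutation fed
with `Node00.N03_at_record₅C`. [cite: Balaban1985BackgroundPropagators, Thms 3.1–3.15 pp.397–432 (bookkeeping: the universal form over the unpinned record is false)] -/
theorem not_b9_main_over_record₅C (F : T4Family) (N : ℕ) [NeZero N] :
    ¬ ∀ (D : FiniteEpsData F (SU N)) (w : WorldP), IsRecordOfRecord₅C F N D w → ∀ P : B12.RunParams, Dag.B9_main (leavesP w P) :=
  B9LeafUnpinnedRecord5C.not_b9_main_over_record₅C_of_b6_main F N fun _ _ h P => N03_at_record₅C h P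

/-- **N06 AS TYPED IS REFUTABLE OVER `IsRecordOfRecord₈C`** (records exist: `Node00.Record8Inhabited.exists_isRecordOfRecord₈C`, dag-n23-b).
[cite: Balaban1985BackgroundPropagators, Thms 3.1–3.15 pp.397–432 (bookkeeping: the universal form over the unpinned Stage-8 record is false)] -/
theorem not_b9_main_over_record₈C (F : T4Family) (N : ℕ) [NeZero N] :
    ¬ ∀ (D : FiniteEpsData F (SU N)) (w : WorldP), IsRecordOfRecord₈C F N D w → ∀ P : B12.RunParams, Dag.B9_main (leavesP w P) := by
  obtain ⟨D, w, h⟩ := Record8Inhabited.exists_isRecordOfRecord₈C F N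
  exact fun hall => not_forall_record₈C_b9_main h (hall D)

/-- **Every [B9] bundle occurs at some ₈C record** (absolute form of `exists_record₈C_b9_iff`). [cite: Balaban1985BackgroundPropagators, Thms 3.1–3.15 pp.397–432 (bookkeeping)] -/
theorem exists_isRecordOfRecord₈C_b9_iff (F : T4Family) (N : ℕ) [NeZero N] (Y : PrintedCarriers9X) :
    ∃ (D : FiniteEpsData F (SU N)) (w : WorldP), IsRecordOfRecord₈C F N D w ∧ ∀ P : B12.RunParams, ((leavesP w P).b9 ↔ B9LeafX Y) := by
  obtain ⟨D, w, h⟩ := Record8Inhabited.exists_isRecordOfRecord₈C F N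
  obtain ⟨w', hw', hb9⟩ := exists_record₈C_b9_iff h Y
  exact ⟨D, w', hw', hb9⟩

/-- **N06 is UNDETERMINED over `IsRecordOfRecord₈C`** — the §4 template of the ₅C module (`B9LeafUnpinnedRecord5C.b9_main_undetermined_of_free`) instantiated at ₈C: true at
every run of one ₈C record, false (given N03's antecedents, which hold) at every run of another.  Regression of record for the Stage-3′(Y) predicate: its `hfree` must FAIL.
[cite: Balaban1985BackgroundPropagators, Thms 3.1–3.15 pp.397–432 (bookkeeping: independence over the Stage-8 record predicate)] -/
theorem b9_main_undetermined_over_record₈C (F : T4Family) (N : ℕ) [NeZero N] :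
    (∃ (D : FiniteEpsData F (SU N)) (w : WorldP), IsRecordOfRecord₈C F N D w ∧ ∀ P : B12.RunParams, Dag.B9_main (leavesP w P)) ∧
    (∃ (D : FiniteEpsData F (SU N)) (w : WorldP), IsRecordOfRecord₈C F N D w ∧
      ∀ P : B12.RunParams, Dag.B6_main (leavesP w P) → ¬ Dag.B9_main (leavesP w P)) :=
  B9LeafUnpinnedRecord5C.b9_main_undetermined_of_free (IsRecordOfRecord₈C F N) (exists_isRecordOfRecord₈C_b9_iff F N)
    (fun _ _ h P => b4_main_of_isRecordOfRecord₅C (isRecordOfRecord₅C_of_isRecordOfRecord₈C h) P)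
    (fun _ _ h P => b5_main_of_isRecordOfRecord₅C (isRecordOfRecord₅C_of_isRecordOfRecord₈C h) P)
    (fun _ _ h P => b7_main_of_isRecordOfRecord₅C (isRecordOfRecord₅C_of_isRecordOfRecord₈C h) P)

/-- The outright dichotomy over ₈C: one record world with N06 at every run, one with `¬` N06 at every run.
[cite: Balaban1985BackgroundPropagators, Thms 3.1–3.15 pp.397–432 (bookkeeping)] -/
theorem b9_main_dichotomy_over_record₈C (F : T4Family) (N : ℕ) [NeZero N] :
    (∃ (D : FiniteEpsData F (SU N)) (w : WorldP), IsRecordOfRecord₈C F N D w ∧ ∀ P : B12.RunParams, Dag.B9_main (leavesP w P)) ∧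
    (∃ (D : FiniteEpsData F (SU N)) (w : WorldP), IsRecordOfRecord₈C F N D w ∧ ∀ P : B12.RunParams, ¬ Dag.B9_main (leavesP w P)) := by
  obtain ⟨D, w, h⟩ := Record8Inhabited.exists_isRecordOfRecord₈C F N
  obtain ⟨w₁, hw₁, h₁⟩ := exists_record₈C_b9_main h
  obtain ⟨w₀, hw₀, h₀⟩ := exists_record₈C_not_b9_main h
  exact ⟨⟨D, w₁, hw₁, fun P => (h₁ P).2⟩, ⟨D, w₀, hw₀, h₀⟩⟩

end Literature.MathematicalPhysics.QuantumFieldTheory.Balaban1983to89.B9LeafRecord8C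

end
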